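/-
Copyright: the b2b-balaban T⁴-continuum CRUX team, row NE7b OWNER lineage `t4-ne7b-p1` (gen 143). Project licence.
-/
import Summits.QuantumFields.BalabanUV.T4Continuum.Spine.NE7b.SupWhitenedHessianObservableMoments
import Summits.QuantumFields.BalabanUV.T4Continuum.Spine.NE7b.SupWhitenedObservableSixthMoment
import Summits.QuantumFields.BalabanUV.T4Continuum.Spine.NE7b.SupBlockThirdKernelAverage

/-!
# THE ORDER-5 VERTEX MOMENT LETTERS UNDER `N(0,AAᵀ)` (SCOPING (d14)(2)(iv)): the THIRD-DERIVATIVE-ENTRY observable's fourth moment and the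
# HESSIAN-ENTRY observable's sixth moment — the two letters the three- and four-point pieces of `∂⁵W` (`κ₃(U‴,U′,U′)`, `κ₃(U″,U″,U′)` via (461),
# `κ₄(U″,U′,U′,U′)` via (496)) consume.  `T_{xyz}(ξ) = U‴(Aξ+ψ)[e_x,e_y,e_z]` is `ξ`-`C¹` with `D_ξT_{xyz} = (U⁗(Aξ+ψ)[·,e_x,e_y,e_z])∘A` of norm
# `≤ κ₄√γ_op` (`‖U⁗‖ ≤ κ₄`) and bounded by `κ₃`, hence by (503)  `E_ν(T_{xyz} − ET_{xyz})⁴ ≤ 5κ₄⁴γ_op²∕(1−λγ_op)²`; the Hessian-entry observable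
# `G_{xy}` ((506): norm of `D_ξ` `≤ κ₃√γ_op`, bounded by `κ₂`) has by (504)  `E_ν(G_{xy} − EG_{xy})⁶ ≤ 50κ₃⁶γ_op³∕(1−λγ_op)³` — both in (461)∕(496)'s
# Gibbs format on `ℝ^κ`, uniformly in the background, the sites and the volume (row NE7b, node U5c; (503) `obs_fourth_moment_le`, (504)
# `obs_sixth_moment_le`, (506) `whitened_hessian_obs_hasFDerivAt`∕`whitened_hessian_obs_power_integrable`∕`hessian_entry_abs_le`, (464)
# `opNorm_matrixCLM_le`, (458), (457) BY NAME; [folklore] + [cite: BrascampLieb1976, Thm 4.1] through (422))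

Cell `pub-balaban`, sub-cell `t4`, spine estimate NE7b (`T4WeightBudget.RelWeightBound`; the cell's OWN estimate — NOT PRINTED in
[Bałaban 1983–89], NOT PROVED).  Crux-route work under `Spine/NE7b/` by the row OWNER (`t4-ne7b-p1` gen 143, file (565)) under FREEZE
(0)'s crux-prover clause; NOTHING of Bałaban's is named as a Lean object, valued or asserted; no `T4Continuum/Support` leaf typed; no
`def`, no notation; zero `sorry`.  Imports (BY NAME): the OWNER's (506) `…SupWhitenedHessianObservableMoments`, (504)
`…SupWhitenedObservableSixthMoment` (`obs_sixth_moment_le`; through them (503), (464), (458), (457)), (419) `…SupBlockThirdKernelAverage`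
(`third_entry_abs_le`).

WHAT IS PROVED ([folklore]):
* §1 `hasFDerivAt_thirdObservable`, **`whitened_third_obs_hasFDerivAt`** (norm `≤ κ₄√γ_op`), `whitened_third_obs_power_integrable`
  ((419) `third_entry_abs_le` reused).
* §2 **`whitened_third_obs_fourth_moment`**, **`whitened_third_obs_fourth_power_integrable`**, **`whitened_third_obs_fourth_moment_gibbs`**.
* §3 **`whitened_hessian_obs_sixth_power_integrable`**, **`whitened_hessian_obs_sixth_moment_gibbs`**; §4 toy.

HONEST (what this is NOT).  Moment letters of the order-5 vertices; the mixed cumulants `κ₃(U‴,U′,U′)`, `κ₃(U″,U″,U′)`, `κ₄(U″,U′,U′,U′)`, their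
tree decay, row letters and the FORM of `∂⁵W` are NOT typed here.  Scalar skeleton ((A3), NC-NE7b-α UNRULED); nothing of Bałaban's asserted.
BY-NAME EFFECT ON THE WALL: NONE.  NE7b NOT PRINTED ∕ NOT PROVED; spine PROVED 0∕9; rung (B)+1 — the programme's measures remain FINITE-torus
statements; NOT the mass gap, NOT Clay.  HONEST DEPENDENCY: continuum YM on T⁴ ⇐ BetaPertH ∧ nine spine estimates (0∕9 proved); BetaPertH ⇐
(D1) ∧ (D4) ∧ CAP+tail; G-an2-4 gates asym, D1 and NE2∕3∕4.
-/

set_option autoImplicit false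
set_option maxSynthPendingDepth 3

noncomputable section

namespace Summit.QuantumFields.BalabanUV.T4Continuum.NE7b.SupWhitenedVertexMomentLetters

open MeasureTheory ProbabilityTheory Real Set Function Finset Matrix
open scoped BigOperators
open Literature.Probability.Distributions (matrixCLM)
open SupWhitenedObservableMoments (obs_fourth_moment_le)
open SupWhitenedObservableSixthMoment (obs_sixth_moment_le)
open SupWhitenedHessianObservableMoments (whitened_hessian_obs_hasFDerivAt whitened_hessian_obs_power_integrable hessian_entry_abs_le)
open SupWhitenedPoincareLetters (opNorm_matrixCLM_le)
open SupWhitenedMomentLetters (op_letter_nonneg whitened_exp_integrable)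
open SupWhitenedCovarianceKernelLetter (whitened_tilted_eq_gauss whitened_integrable_lebesgue)
open SupBlockThirdKernelAverage (third_entry_abs_le)

variable {ι κ : Type} [Fintype ι] [DecidableEq ι] [Fintype κ] [DecidableEq κ]

variable {U : EuclideanSpace ℝ ι → ℝ} {U' : EuclideanSpace ℝ ι → EuclideanSpace ℝ ι →L[ℝ] ℝ}
  {U'' : EuclideanSpace ℝ ι → EuclideanSpace ℝ ι →L[ℝ] EuclideanSpace ℝ ι →L[ℝ] ℝ}
  {U₃ : EuclideanSpace ℝ ι → EuclideanSpace ℝ ι →L[ℝ] EuclideanSpace ℝ ι →L[ℝ] EuclideanSpace ℝ ι →L[ℝ] ℝ}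
  {U₄ : EuclideanSpace ℝ ι → EuclideanSpace ℝ ι →L[ℝ] EuclideanSpace ℝ ι →L[ℝ] EuclideanSpace ℝ ι →L[ℝ] EuclideanSpace ℝ ι →L[ℝ] ℝ} {A : Matrix ι κ ℝ}
  {γop κ₀ κ₂ κ₃ κ₄ τ θ lam : ℝ}

/-! ## §1. The third-derivative-entry observable is `C¹` with a bounded derivative, and bounded -/

set_option synthInstance.maxHeartbeats 200000 in
omit [DecidableEq ι] in
/-- **`D_ω(U‴(ω+ψ)[h,k,l]) = U⁗(ω+ψ)[·,h,k,l]`** (as the composite `(ev_l ∘ ev_k ∘ ev_h) ∘ U⁗(ω+ψ)`), a continuous map of `ω`, of norm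
`≤ κ₄‖h‖‖k‖‖l‖`. [folklore] -/
theorem hasFDerivAt_thirdObservable (hU₃d : ∀ φ : EuclideanSpace ℝ ι, HasFDerivAt U₃ (U₄ φ) φ) (hU₄c : Continuous U₄)
    (hU₄b : ∀ φ : EuclideanSpace ℝ ι, ‖U₄ φ‖ ≤ κ₄) (ψ h k l : EuclideanSpace ℝ ι) :
    (∀ ω : EuclideanSpace ℝ ι, HasFDerivAt (fun ω : EuclideanSpace ℝ ι => U₃ (ω + ψ) h k l)
        ((((ContinuousLinearMap.apply ℝ ℝ l).comp (ContinuousLinearMap.apply ℝ (EuclideanSpace ℝ ι →L[ℝ] ℝ) k)).comp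
          (ContinuousLinearMap.apply ℝ (EuclideanSpace ℝ ι →L[ℝ] EuclideanSpace ℝ ι →L[ℝ] ℝ) h)).comp (U₄ (ω + ψ))) ω) ∧
      Continuous (fun ω : EuclideanSpace ℝ ι =>
        (((ContinuousLinearMap.apply ℝ ℝ l).comp (ContinuousLinearMap.apply ℝ (EuclideanSpace ℝ ι →L[ℝ] ℝ) k)).comp
          (ContinuousLinearMap.apply ℝ (EuclideanSpace ℝ ι →L[ℝ] EuclideanSpace ℝ ι →L[ℝ] ℝ) h)).comp (U₄ (ω + ψ))) ∧
      ∀ ω : EuclideanSpace ℝ ι,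
        ‖(((ContinuousLinearMap.apply ℝ ℝ l).comp (ContinuousLinearMap.apply ℝ (EuclideanSpace ℝ ι →L[ℝ] ℝ) k)).comp
          (ContinuousLinearMap.apply ℝ (EuclideanSpace ℝ ι →L[ℝ] EuclideanSpace ℝ ι →L[ℝ] ℝ) h)).comp (U₄ (ω + ψ))‖ ≤ κ₄ * ‖h‖ * ‖k‖ * ‖l‖ := by
  have hsh : ∀ ω : EuclideanSpace ℝ ι, HasFDerivAt (fun ω : EuclideanSpace ℝ ι => ω + ψ) (ContinuousLinearMap.id ℝ (EuclideanSpace ℝ ι)) ω :=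
    fun ω => (hasFDerivAt_id ω).add_const ψ
  have hκ₄ : 0 ≤ κ₄ := (norm_nonneg (U₄ ψ)).trans (hU₄b ψ)
  refine ⟨fun ω => ?_, ?_, fun ω => ?_⟩
  · have h1 : HasFDerivAt (fun ω : EuclideanSpace ℝ ι => U₃ (ω + ψ)) (U₄ (ω + ψ)) ω := by
      have h := (hU₃d (ω + ψ)).comp ω (hsh ω); rw [ContinuousLinearMap.comp_id] at h; exact h
    have h2 := (((ContinuousLinearMap.apply ℝ ℝ l).comp (ContinuousLinearMap.apply ℝ (EuclideanSpace ℝ ι →L[ℝ] ℝ) k)).comp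
      (ContinuousLinearMap.apply ℝ (EuclideanSpace ℝ ι →L[ℝ] EuclideanSpace ℝ ι →L[ℝ] ℝ) h)).hasFDerivAt.comp ω h1
    simpa [Function.comp_def] using h2
  · exact continuous_const.clm_comp (hU₄c.comp (continuous_id.add continuous_const))
  · refine ContinuousLinearMap.opNorm_le_bound _ (by positivity) fun v => ?_
    simp only [ContinuousLinearMap.coe_comp, Function.comp_apply, ContinuousLinearMap.apply_apply]
    calc ‖U₄ (ω + ψ) v h k l‖ ≤ ‖U₄ (ω + ψ) v h k‖ * ‖l‖ := ContinuousLinearMap.le_opNorm _ _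
      _ ≤ ‖U₄ (ω + ψ) v h‖ * ‖k‖ * ‖l‖ := mul_le_mul_of_nonneg_right (ContinuousLinearMap.le_opNorm _ _) (norm_nonneg _)
      _ ≤ ‖U₄ (ω + ψ) v‖ * ‖h‖ * ‖k‖ * ‖l‖ :=
        mul_le_mul_of_nonneg_right (mul_le_mul_of_nonneg_right (ContinuousLinearMap.le_opNorm _ _) (norm_nonneg _)) (norm_nonneg _)
      _ ≤ ‖U₄ (ω + ψ)‖ * ‖v‖ * ‖h‖ * ‖k‖ * ‖l‖ := mul_le_mul_of_nonneg_right (mul_le_mul_of_nonneg_right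
          (mul_le_mul_of_nonneg_right (ContinuousLinearMap.le_opNorm _ _) (norm_nonneg _)) (norm_nonneg _)) (norm_nonneg _)
      _ ≤ κ₄ * ‖v‖ * ‖h‖ * ‖k‖ * ‖l‖ := mul_le_mul_of_nonneg_right (mul_le_mul_of_nonneg_right (mul_le_mul_of_nonneg_right
          (mul_le_mul_of_nonneg_right (hU₄b _) (norm_nonneg _)) (norm_nonneg _)) (norm_nonneg _)) (norm_nonneg _)
      _ = κ₄ * ‖h‖ * ‖k‖ * ‖l‖ * ‖v‖ := by ring

set_option synthInstance.maxHeartbeats 200000 in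
/-- **`D_ξ T_{xyz} = (U⁗(Aξ+ψ)[·,e_x,e_y,e_z]) ∘ A`**, continuous in `ξ`, of norm `≤ κ₄√γ_op`. [folklore] -/
theorem whitened_third_obs_hasFDerivAt [Nonempty ι] (hΓop : (γop • (1 : Matrix ι ι ℝ) - A * Aᵀ).PosSemidef)
    (hU₃d : ∀ φ : EuclideanSpace ℝ ι, HasFDerivAt U₃ (U₄ φ) φ) (hU₄c : Continuous U₄) (hU₄b : ∀ φ : EuclideanSpace ℝ ι, ‖U₄ φ‖ ≤ κ₄)
    (ψ : EuclideanSpace ℝ ι) (x y z : ι) :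
    (∀ ξ : EuclideanSpace ℝ κ, HasFDerivAt (fun ξ : EuclideanSpace ℝ κ => U₃ (matrixCLM A ξ + ψ) (EuclideanSpace.single x (1 : ℝ))
        (EuclideanSpace.single y (1 : ℝ)) (EuclideanSpace.single z (1 : ℝ)))
        (((((ContinuousLinearMap.apply ℝ ℝ (EuclideanSpace.single z (1 : ℝ))).comp (ContinuousLinearMap.apply ℝ (EuclideanSpace ℝ ι →L[ℝ] ℝ)
            (EuclideanSpace.single y (1 : ℝ)))).comp (ContinuousLinearMap.apply ℝ (EuclideanSpace ℝ ι →L[ℝ] EuclideanSpace ℝ ι →L[ℝ] ℝ)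
            (EuclideanSpace.single x (1 : ℝ)))).comp (U₄ (matrixCLM A ξ + ψ))).comp (matrixCLM A)) ξ) ∧
      Continuous (fun ξ : EuclideanSpace ℝ κ => ((((ContinuousLinearMap.apply ℝ ℝ (EuclideanSpace.single z (1 : ℝ))).comp
          (ContinuousLinearMap.apply ℝ (EuclideanSpace ℝ ι →L[ℝ] ℝ) (EuclideanSpace.single y (1 : ℝ)))).comp
          (ContinuousLinearMap.apply ℝ (EuclideanSpace ℝ ι →L[ℝ] EuclideanSpace ℝ ι →L[ℝ] ℝ) (EuclideanSpace.single x (1 : ℝ)))).comp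
          (U₄ (matrixCLM A ξ + ψ))).comp (matrixCLM A)) ∧
      ∀ ξ : EuclideanSpace ℝ κ, ‖((((ContinuousLinearMap.apply ℝ ℝ (EuclideanSpace.single z (1 : ℝ))).comp
          (ContinuousLinearMap.apply ℝ (EuclideanSpace ℝ ι →L[ℝ] ℝ) (EuclideanSpace.single y (1 : ℝ)))).comp
          (ContinuousLinearMap.apply ℝ (EuclideanSpace ℝ ι →L[ℝ] EuclideanSpace ℝ ι →L[ℝ] ℝ) (EuclideanSpace.single x (1 : ℝ)))).comp
          (U₄ (matrixCLM A ξ + ψ))).comp (matrixCLM A)‖ ≤ κ₄ * Real.sqrt γop := by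
  obtain ⟨hGd, hG'c, hG'b⟩ := hasFDerivAt_thirdObservable hU₃d hU₄c hU₄b ψ (EuclideanSpace.single x (1 : ℝ)) (EuclideanSpace.single y (1 : ℝ))
    (EuclideanSpace.single z (1 : ℝ))
  have hx : ‖((EuclideanSpace.single x (1 : ℝ)) : EuclideanSpace ℝ ι)‖ = 1 := by simp
  have hy : ‖((EuclideanSpace.single y (1 : ℝ)) : EuclideanSpace ℝ ι)‖ = 1 := by simp
  have hz : ‖((EuclideanSpace.single z (1 : ℝ)) : EuclideanSpace ℝ ι)‖ = 1 := by simp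
  refine ⟨fun ξ => ?_, ?_, fun ξ => ?_⟩
  · exact (hGd (matrixCLM A ξ)).comp ξ (matrixCLM A).hasFDerivAt
  · exact ((ContinuousLinearMap.compL ℝ (EuclideanSpace ℝ κ) (EuclideanSpace ℝ ι) ℝ).flip (matrixCLM A)).continuous.comp
      (hG'c.comp (matrixCLM A).continuous)
  · have hb' := hG'b (matrixCLM A ξ)
    rw [hx, hy, hz, mul_one, mul_one, mul_one] at hb'
    exact (ContinuousLinearMap.opNorm_comp_le _ _).trans (mul_le_mul hb' (opNorm_matrixCLM_le hΓop) (norm_nonneg _) (le_trans (norm_nonneg _)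
      hb'))

/-- **`e^{−U(Aξ+ψ)}·T_{xyz}(ξ)^k ∈ L¹(N(0,I_κ))`** for every `k` (`|T_{xyz}| ≤ κ₃`, the exponential weight integrable under the regulator).
[folklore] -/
theorem whitened_third_obs_power_integrable (hΓop : (γop • (1 : Matrix ι ι ℝ) - A * Aᵀ).PosSemidef) (Y : Finset ι)
    (hUd : ∀ φ : EuclideanSpace ℝ ι, HasFDerivAt U (U' φ) φ)
    (hU₃d : ∀ φ : EuclideanSpace ℝ ι, HasFDerivAt U₃ (U₄ φ) φ) (hκ₀ : 0 ≤ κ₀) (hτ : 0 < τ) (hθ1 : θ < 1) (hκθ : 2 * κ₀ * (1 + τ) * γop ≤ θ)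
    (hstab : ∀ φ : EuclideanSpace ℝ ι, -(κ₀ * ∑ x ∈ Y, φ x ^ 2) ≤ U φ) (hU₃b : ∀ φ : EuclideanSpace ℝ ι, ‖U₃ φ‖ ≤ κ₃)
    (ψ : EuclideanSpace ℝ ι) (x y z : ι) (k : ℕ) :
    Integrable (fun ξ : EuclideanSpace ℝ κ => exp (-U (matrixCLM A ξ + ψ)) * U₃ (matrixCLM A ξ + ψ) (EuclideanSpace.single x (1 : ℝ))
        (EuclideanSpace.single y (1 : ℝ)) (EuclideanSpace.single z (1 : ℝ)) ^ k) (multivariateGaussian 0 (1 : Matrix κ κ ℝ)) := by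
  have hUc : Continuous U := continuous_iff_continuousAt.2 fun φ => (hUd φ).continuousAt
  have hU₃c : Continuous U₃ := continuous_iff_continuousAt.2 fun φ => (hU₃d φ).continuousAt
  have hI := whitened_exp_integrable hΓop Y hUc.measurable hκ₀ hτ hθ1 hκθ hstab ψ
  have hsh : Continuous fun ξ : EuclideanSpace ℝ κ => matrixCLM A ξ + ψ := (matrixCLM A).continuous.add continuous_const
  have hEc : Continuous fun ξ : EuclideanSpace ℝ κ => exp (-U (matrixCLM A ξ + ψ)) := continuous_exp.comp ((hUc.comp hsh).neg)
  have hGc : Continuous fun ξ : EuclideanSpace ℝ κ => U₃ (matrixCLM A ξ + ψ) (EuclideanSpace.single x (1 : ℝ)) (EuclideanSpace.single y (1 : ℝ))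
      (EuclideanSpace.single z (1 : ℝ)) :=
    (((hU₃c.comp hsh).clm_apply continuous_const).clm_apply continuous_const).clm_apply continuous_const
  have hκ₃ : 0 ≤ κ₃ := (norm_nonneg (U₃ ψ)).trans (hU₃b ψ)
  refine (hI.mul_const (κ₃ ^ k)).mono' ((hEc.mul (hGc.pow k)).aestronglyMeasurable) (ae_of_all _ fun ξ => ?_)
  rw [Real.norm_eq_abs, abs_mul, abs_of_pos (exp_pos _), abs_pow]
  exact mul_le_mul_of_nonneg_left (pow_le_pow_left₀ (abs_nonneg _) (third_entry_abs_le hU₃b _ x y z) k) (exp_pos _).le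

/-! ## §2. The fourth centred moment of the third-derivative-entry observable -/

/-- **`Z⁻¹∫e(T_{xyz} − μ)⁴ ≤ 5κ₄⁴γ_op²∕(1 − λγ_op)²`** in the whitened coordinates ((503) with `L = κ₄√γ_op`); uniform in `ψ`, the sites
and the volume. [folklore] -/
theorem whitened_third_obs_fourth_moment [Nonempty ι] (hΓop : (γop • (1 : Matrix ι ι ℝ) - A * Aᵀ).PosSemidef) (Y : Finset ι)
    (hUd : ∀ φ : EuclideanSpace ℝ ι, HasFDerivAt U (U' φ) φ)
    (hU₃d : ∀ φ : EuclideanSpace ℝ ι, HasFDerivAt U₃ (U₄ φ) φ) (hU₄c : Continuous U₄) (hκ₀ : 0 ≤ κ₀) (hτ : 0 < τ) (hθ1 : θ < 1)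
    (hκθ : 2 * κ₀ * (1 + τ) * γop ≤ θ) (hstab : ∀ φ : EuclideanSpace ℝ ι, -(κ₀ * ∑ x ∈ Y, φ x ^ 2) ≤ U φ)
    (hU₃b : ∀ φ : EuclideanSpace ℝ ι, ‖U₃ φ‖ ≤ κ₃) (hU₄b : ∀ φ : EuclideanSpace ℝ ι, ‖U₄ φ‖ ≤ κ₄) (hlam : 0 ≤ lam)
    (hUsec : ∀ s : ℝ, 0 ≤ s → s ≤ 1 → ∀ a b : EuclideanSpace ℝ ι,
      U ((1 - s) • a + s • b) - lam / 2 * (s * (1 - s)) * ∑ i, (a i - b i) ^ 2 ≤ (1 - s) * U a + s * U b)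
    (hρ : lam * γop < 1) (ψ : EuclideanSpace ℝ ι) (x y z : ι) :
    (∫ ξ : EuclideanSpace ℝ κ, exp (-U (matrixCLM A ξ + ψ)) ∂(multivariateGaussian 0 (1 : Matrix κ κ ℝ)))⁻¹ *
        (∫ ξ : EuclideanSpace ℝ κ, exp (-U (matrixCLM A ξ + ψ)) * (U₃ (matrixCLM A ξ + ψ) (EuclideanSpace.single x (1 : ℝ)) (EuclideanSpace.single y
            (1 : ℝ)) (EuclideanSpace.single z (1 : ℝ)) -
          ((∫ ξ : EuclideanSpace ℝ κ, exp (-U (matrixCLM A ξ + ψ)) ∂(multivariateGaussian 0 (1 : Matrix κ κ ℝ)))⁻¹ * (∫ ξ : EuclideanSpace ℝ κ, exp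
              (-U (matrixCLM A ξ + ψ)) * U₃ (matrixCLM A ξ + ψ) (EuclideanSpace.single x (1 : ℝ)) (EuclideanSpace.single y (1 : ℝ))
              (EuclideanSpace.single z (1 : ℝ)) ∂(multivariateGaussian 0 (1 : Matrix κ κ ℝ))))) ^ 4
          ∂(multivariateGaussian 0 (1 : Matrix κ κ ℝ))) ≤
      5 * (κ₄ ^ 4 * γop ^ 2) / (1 - lam * γop) ^ 2 := by
  have hγ := op_letter_nonneg hΓop
  obtain ⟨hgd, hg'c, hg'b⟩ := whitened_third_obs_hasFDerivAt hΓop hU₃d hU₄c hU₄b ψ x y z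
  have k1 := whitened_third_obs_power_integrable hΓop Y hUd hU₃d hκ₀ hτ hθ1 hκθ hstab hU₃b ψ x y z 1
  have k2 := whitened_third_obs_power_integrable hΓop Y hUd hU₃d hκ₀ hτ hθ1 hκθ hstab hU₃b ψ x y z 2
  have k4 := whitened_third_obs_power_integrable hΓop Y hUd hU₃d hκ₀ hτ hθ1 hκθ hstab hU₃b ψ x y z 4
  simp only [pow_one] at k1
  have h := obs_fourth_moment_le hΓop Y hUd hκ₀ hτ hθ1 hκθ hstab hlam hUsec hρ ψ hgd hg'c hg'b k1 k2 k4
  have hL4 : (κ₄ * Real.sqrt γop) ^ 4 = κ₄ ^ 4 * γop ^ 2 := by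
    have h2 : Real.sqrt γop ^ 2 = γop := Real.sq_sqrt hγ
    calc (κ₄ * Real.sqrt γop) ^ 4 = κ₄ ^ 4 * (Real.sqrt γop ^ 2) ^ 2 := by ring
      _ = κ₄ ^ 4 * γop ^ 2 := by rw [h2]
  rw [hL4] at h
  exact h

/-- **`(T_{xyz} − c)⁴ ∈ L¹(ν)`** for every constant `c` ((461)'s `hG4`), `ν ∝ e^{−V}dz`, `V(z) = ½z·z + U(A toLp z + ψ)`. [folklore] -/
theorem whitened_third_obs_fourth_power_integrable (hΓop : (γop • (1 : Matrix ι ι ℝ) - A * Aᵀ).PosSemidef) (Y : Finset ι)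
    (hUd : ∀ φ : EuclideanSpace ℝ ι, HasFDerivAt U (U' φ) φ)
    (hU₃d : ∀ φ : EuclideanSpace ℝ ι, HasFDerivAt U₃ (U₄ φ) φ) (hκ₀ : 0 ≤ κ₀) (hτ : 0 < τ) (hθ1 : θ < 1) (hκθ : 2 * κ₀ * (1 + τ) * γop ≤ θ)
    (hstab : ∀ φ : EuclideanSpace ℝ ι, -(κ₀ * ∑ x ∈ Y, φ x ^ 2) ≤ U φ) (hU₃b : ∀ φ : EuclideanSpace ℝ ι, ‖U₃ φ‖ ≤ κ₃)
    (ψ : EuclideanSpace ℝ ι) (x y z : ι) (c : ℝ) :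
    Integrable (fun w : κ → ℝ => (U₃ (matrixCLM A (WithLp.toLp 2 w) + ψ) (EuclideanSpace.single x (1 : ℝ)) (EuclideanSpace.single y (1 : ℝ))
        (EuclideanSpace.single z (1 : ℝ)) - c) ^ 4)
      ((volume : Measure (κ → ℝ)).tilted fun z => -(1 / 2 * (z ⬝ᵥ z) + U (matrixCLM A (WithLp.toLp 2 z) + ψ))) := by
  have hUc : Continuous U := continuous_iff_continuousAt.2 fun φ => (hUd φ).continuousAt
  have hU₃c : Continuous U₃ := continuous_iff_continuousAt.2 fun φ => (hU₃d φ).continuousAt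
  have hI := whitened_exp_integrable hΓop Y hUc.measurable hκ₀ hτ hθ1 hκθ hstab ψ
  have hsh : Continuous fun ξ : EuclideanSpace ℝ κ => matrixCLM A ξ + ψ := (matrixCLM A).continuous.add continuous_const
  have hEc : Continuous fun ξ : EuclideanSpace ℝ κ => exp (-U (matrixCLM A ξ + ψ)) := continuous_exp.comp ((hUc.comp hsh).neg)
  have hGc : Continuous fun ξ : EuclideanSpace ℝ κ => U₃ (matrixCLM A ξ + ψ) (EuclideanSpace.single x (1 : ℝ)) (EuclideanSpace.single y (1 : ℝ))
      (EuclideanSpace.single z (1 : ℝ)) :=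
    (((hU₃c.comp hsh).clm_apply continuous_const).clm_apply continuous_const).clm_apply continuous_const
  have hκ₃ : 0 ≤ κ₃ := (norm_nonneg (U₃ ψ)).trans (hU₃b ψ)
  have ig4 : Integrable (fun ξ : EuclideanSpace ℝ κ => exp (-U (matrixCLM A ξ + ψ)) * (U₃ (matrixCLM A ξ + ψ) (EuclideanSpace.single x (1 : ℝ))
      (EuclideanSpace.single y (1 : ℝ)) (EuclideanSpace.single z (1 : ℝ)) - c) ^ 4) (multivariateGaussian 0 (1 : Matrix κ κ ℝ)) := by
    refine (hI.mul_const ((κ₃ + |c|) ^ 4)).mono' ((hEc.mul ((hGc.sub continuous_const).pow 4)).aestronglyMeasurable) (ae_of_all _ fun ξ => ?_)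
    rw [Real.norm_eq_abs, abs_mul, abs_of_pos (exp_pos _), abs_pow]
    refine mul_le_mul_of_nonneg_left (pow_le_pow_left₀ (abs_nonneg _) ?_ 4) (exp_pos _).le
    exact (abs_sub _ _).trans (add_le_add (third_entry_abs_le hU₃b _ x y z) le_rfl)
  have hL := whitened_integrable_lebesgue A ψ (k := fun ξ : EuclideanSpace ℝ κ => (U₃ (matrixCLM A ξ + ψ) (EuclideanSpace.single x (1 : ℝ))
      (EuclideanSpace.single y (1 : ℝ)) (EuclideanSpace.single z (1 : ℝ)) - c) ^ 4) ig4
  have hV0 : Integrable (fun z : κ → ℝ => exp (-(1 / 2 * (z ⬝ᵥ z) + U (matrixCLM A (WithLp.toLp 2 z) + ψ)))) := by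
    have h := whitened_integrable_lebesgue A ψ (k := fun _ => (1 : ℝ)) (by simpa only [mul_one] using hI)
    simpa only [one_mul] using h
  rw [integrable_tilted_iff hV0]
  refine hL.congr (ae_of_all _ fun w => ?_)
  simp only [smul_eq_mul]
  ring

/-- **THE FOURTH CENTRED MOMENT OF THE THIRD-DERIVATIVE-ENTRY OBSERVABLE IN (461)'s FORMAT**:
`∫(T_{xyz} − E_νT_{xyz})⁴dν ≤ 5κ₄⁴γ_op²∕(1 − λγ_op)²`; uniform in the background, the sites and the volume. [folklore] -/
theorem whitened_third_obs_fourth_moment_gibbs [Nonempty ι] (hΓop : (γop • (1 : Matrix ι ι ℝ) - A * Aᵀ).PosSemidef) (Y : Finset ι)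
    (hUd : ∀ φ : EuclideanSpace ℝ ι, HasFDerivAt U (U' φ) φ)
    (hU₃d : ∀ φ : EuclideanSpace ℝ ι, HasFDerivAt U₃ (U₄ φ) φ) (hU₄c : Continuous U₄) (hκ₀ : 0 ≤ κ₀) (hτ : 0 < τ) (hθ1 : θ < 1)
    (hκθ : 2 * κ₀ * (1 + τ) * γop ≤ θ) (hstab : ∀ φ : EuclideanSpace ℝ ι, -(κ₀ * ∑ x ∈ Y, φ x ^ 2) ≤ U φ)
    (hU₃b : ∀ φ : EuclideanSpace ℝ ι, ‖U₃ φ‖ ≤ κ₃) (hU₄b : ∀ φ : EuclideanSpace ℝ ι, ‖U₄ φ‖ ≤ κ₄) (hlam : 0 ≤ lam)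
    (hUsec : ∀ s : ℝ, 0 ≤ s → s ≤ 1 → ∀ a b : EuclideanSpace ℝ ι,
      U ((1 - s) • a + s • b) - lam / 2 * (s * (1 - s)) * ∑ i, (a i - b i) ^ 2 ≤ (1 - s) * U a + s * U b)
    (hρ : lam * γop < 1) (ψ : EuclideanSpace ℝ ι) (x y z : ι) :
    ∫ w, (U₃ (matrixCLM A (WithLp.toLp 2 w) + ψ) (EuclideanSpace.single x (1 : ℝ)) (EuclideanSpace.single y (1 : ℝ)) (EuclideanSpace.single z (1 :
        ℝ)) -
          ∫ w', U₃ (matrixCLM A (WithLp.toLp 2 w') + ψ) (EuclideanSpace.single x (1 : ℝ)) (EuclideanSpace.single y (1 : ℝ))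
            (EuclideanSpace.single z (1 : ℝ)) ∂((volume : Measure (κ → ℝ)).tilted fun z => -(1 / 2 * (z ⬝ᵥ z) + U (matrixCLM A (WithLp.toLp 2 z) +
                ψ)))) ^ 4
        ∂((volume : Measure (κ → ℝ)).tilted fun z => -(1 / 2 * (z ⬝ᵥ z) + U (matrixCLM A (WithLp.toLp 2 z) + ψ))) ≤
      5 * (κ₄ ^ 4 * γop ^ 2) / (1 - lam * γop) ^ 2 := by
  have h := whitened_third_obs_fourth_moment hΓop Y hUd hU₃d hU₄c hκ₀ hτ hθ1 hκθ hstab hU₃b hU₄b hlam hUsec hρ ψ x y z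
  rw [whitened_tilted_eq_gauss A ψ, whitened_tilted_eq_gauss A ψ]
  simp only [WithLp.toLp_ofLp]
  rw [div_eq_inv_mul, div_eq_inv_mul]
  exact h

/-! ## §3. The sixth centred moment of the Hessian-entry observable -/

/-- **`(G_{xy} − c)⁶ ∈ L¹(ν)`** for every constant `c` ((496)'s `hs`), `|G_{xy}| ≤ κ₂`. [folklore] -/
theorem whitened_hessian_obs_sixth_power_integrable (hΓop : (γop • (1 : Matrix ι ι ℝ) - A * Aᵀ).PosSemidef) (Y : Finset ι)
    (hUd : ∀ φ : EuclideanSpace ℝ ι, HasFDerivAt U (U' φ) φ)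
    (hU''d : ∀ φ : EuclideanSpace ℝ ι, HasFDerivAt U'' (U₃ φ) φ) (hκ₀ : 0 ≤ κ₀) (hτ : 0 < τ) (hθ1 : θ < 1) (hκθ : 2 * κ₀ * (1 + τ) * γop ≤ θ)
    (hstab : ∀ φ : EuclideanSpace ℝ ι, -(κ₀ * ∑ x ∈ Y, φ x ^ 2) ≤ U φ) (hU''b : ∀ φ : EuclideanSpace ℝ ι, ‖U'' φ‖ ≤ κ₂)
    (ψ : EuclideanSpace ℝ ι) (x y : ι) (c : ℝ) :
    Integrable (fun w : κ → ℝ => (U'' (matrixCLM A (WithLp.toLp 2 w) + ψ) (EuclideanSpace.single x (1 : ℝ)) (EuclideanSpace.single y (1 : ℝ)) - c) ^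
        6)
      ((volume : Measure (κ → ℝ)).tilted fun z => -(1 / 2 * (z ⬝ᵥ z) + U (matrixCLM A (WithLp.toLp 2 z) + ψ))) := by
  have hUc : Continuous U := continuous_iff_continuousAt.2 fun φ => (hUd φ).continuousAt
  have hU''c : Continuous U'' := continuous_iff_continuousAt.2 fun φ => (hU''d φ).continuousAt
  have hI := whitened_exp_integrable hΓop Y hUc.measurable hκ₀ hτ hθ1 hκθ hstab ψ
  have hsh : Continuous fun ξ : EuclideanSpace ℝ κ => matrixCLM A ξ + ψ := (matrixCLM A).continuous.add continuous_const
  have hEc : Continuous fun ξ : EuclideanSpace ℝ κ => exp (-U (matrixCLM A ξ + ψ)) := continuous_exp.comp ((hUc.comp hsh).neg)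
  have hGc : Continuous fun ξ : EuclideanSpace ℝ κ => U'' (matrixCLM A ξ + ψ) (EuclideanSpace.single x (1 : ℝ)) (EuclideanSpace.single y (1 : ℝ)) :=
    ((hU''c.comp hsh).clm_apply continuous_const).clm_apply continuous_const
  have hκ₂ : 0 ≤ κ₂ := (norm_nonneg (U'' ψ)).trans (hU''b ψ)
  have ig6 : Integrable (fun ξ : EuclideanSpace ℝ κ => exp (-U (matrixCLM A ξ + ψ)) * (U'' (matrixCLM A ξ + ψ) (EuclideanSpace.single x (1 : ℝ))
      (EuclideanSpace.single y (1 : ℝ)) - c) ^ 6) (multivariateGaussian 0 (1 : Matrix κ κ ℝ)) := by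
    refine (hI.mul_const ((κ₂ + |c|) ^ 6)).mono' ((hEc.mul ((hGc.sub continuous_const).pow 6)).aestronglyMeasurable) (ae_of_all _ fun ξ => ?_)
    rw [Real.norm_eq_abs, abs_mul, abs_of_pos (exp_pos _), abs_pow]
    refine mul_le_mul_of_nonneg_left (pow_le_pow_left₀ (abs_nonneg _) ?_ 6) (exp_pos _).le
    exact (abs_sub _ _).trans (add_le_add (hessian_entry_abs_le hU''b _ x y) le_rfl)
  have hL := whitened_integrable_lebesgue A ψ (k := fun ξ : EuclideanSpace ℝ κ => (U'' (matrixCLM A ξ + ψ) (EuclideanSpace.single x (1 : ℝ))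
      (EuclideanSpace.single y (1 : ℝ)) - c) ^ 6) ig6
  have hV0 : Integrable (fun z : κ → ℝ => exp (-(1 / 2 * (z ⬝ᵥ z) + U (matrixCLM A (WithLp.toLp 2 z) + ψ)))) := by
    have h := whitened_integrable_lebesgue A ψ (k := fun _ => (1 : ℝ)) (by simpa only [mul_one] using hI)
    simpa only [one_mul] using h
  rw [integrable_tilted_iff hV0]
  refine hL.congr (ae_of_all _ fun w => ?_)
  simp only [smul_eq_mul]
  ring

/-- **THE SIXTH CENTRED MOMENT OF THE HESSIAN-ENTRY OBSERVABLE IN (496)'s FORMAT**: `∫(G_{xy} − E_νG_{xy})⁶dν ≤ 50κ₃⁶γ_op³∕(1 − λγ_op)³`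
((504) with `L = κ₃√γ_op`); uniform in the background, the sites and the volume. [folklore] -/
theorem whitened_hessian_obs_sixth_moment_gibbs [Nonempty ι] (hΓop : (γop • (1 : Matrix ι ι ℝ) - A * Aᵀ).PosSemidef) (Y : Finset ι)
    (hUd : ∀ φ : EuclideanSpace ℝ ι, HasFDerivAt U (U' φ) φ)
    (hU''d : ∀ φ : EuclideanSpace ℝ ι, HasFDerivAt U'' (U₃ φ) φ) (hU₃c : Continuous U₃) (hκ₀ : 0 ≤ κ₀) (hτ : 0 < τ) (hθ1 : θ < 1)
    (hκθ : 2 * κ₀ * (1 + τ) * γop ≤ θ) (hstab : ∀ φ : EuclideanSpace ℝ ι, -(κ₀ * ∑ x ∈ Y, φ x ^ 2) ≤ U φ)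
    (hU''b : ∀ φ : EuclideanSpace ℝ ι, ‖U'' φ‖ ≤ κ₂) (hU₃b : ∀ φ : EuclideanSpace ℝ ι, ‖U₃ φ‖ ≤ κ₃) (hlam : 0 ≤ lam)
    (hUsec : ∀ s : ℝ, 0 ≤ s → s ≤ 1 → ∀ a b : EuclideanSpace ℝ ι,
      U ((1 - s) • a + s • b) - lam / 2 * (s * (1 - s)) * ∑ i, (a i - b i) ^ 2 ≤ (1 - s) * U a + s * U b)
    (hρ : lam * γop < 1) (ψ : EuclideanSpace ℝ ι) (x y : ι) :
    ∫ w, (U'' (matrixCLM A (WithLp.toLp 2 w) + ψ) (EuclideanSpace.single x (1 : ℝ)) (EuclideanSpace.single y (1 : ℝ)) -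
          ∫ w', U'' (matrixCLM A (WithLp.toLp 2 w') + ψ) (EuclideanSpace.single x (1 : ℝ)) (EuclideanSpace.single y (1 : ℝ))
            ∂((volume : Measure (κ → ℝ)).tilted fun z => -(1 / 2 * (z ⬝ᵥ z) + U (matrixCLM A (WithLp.toLp 2 z) + ψ)))) ^ 6
        ∂((volume : Measure (κ → ℝ)).tilted fun z => -(1 / 2 * (z ⬝ᵥ z) + U (matrixCLM A (WithLp.toLp 2 z) + ψ))) ≤
      50 * (κ₃ ^ 6 * γop ^ 3) / (1 - lam * γop) ^ 3 := by
  have hγ := op_letter_nonneg hΓop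
  obtain ⟨hgd, hg'c, hg'b⟩ := whitened_hessian_obs_hasFDerivAt hΓop hU''d hU₃c hU₃b ψ x y
  have k1 := whitened_hessian_obs_power_integrable hΓop Y hUd hU''d hκ₀ hτ hθ1 hκθ hstab hU''b ψ x y 1
  have k2 := whitened_hessian_obs_power_integrable hΓop Y hUd hU''d hκ₀ hτ hθ1 hκθ hstab hU''b ψ x y 2
  have k4 := whitened_hessian_obs_power_integrable hΓop Y hUd hU''d hκ₀ hτ hθ1 hκθ hstab hU''b ψ x y 4
  have k6 := whitened_hessian_obs_power_integrable hΓop Y hUd hU''d hκ₀ hτ hθ1 hκθ hstab hU''b ψ x y 6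
  simp only [pow_one] at k1
  have h := obs_sixth_moment_le hΓop Y hUd hκ₀ hτ hθ1 hκθ hstab hlam hUsec hρ ψ hgd hg'c hg'b k1 k2 k4 k6
  have hL6 : (κ₃ * Real.sqrt γop) ^ 6 = κ₃ ^ 6 * γop ^ 3 := by
    have h2 : Real.sqrt γop ^ 2 = γop := Real.sq_sqrt hγ
    calc (κ₃ * Real.sqrt γop) ^ 6 = κ₃ ^ 6 * (Real.sqrt γop ^ 2) ^ 3 := by ring
      _ = κ₃ ^ 6 * γop ^ 3 := by rw [h2]
  rw [hL6] at h
  rw [whitened_tilted_eq_gauss A ψ, whitened_tilted_eq_gauss A ψ]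
  simp only [WithLp.toLp_ofLp]
  rw [div_eq_inv_mul, div_eq_inv_mul]
  exact h

/-! ## §4. Toy -/

/-- Toy (`(κ√γ)⁶ = κ⁶γ³` at `κ = γ = 1`). -/
example : ((1 : ℝ) * Real.sqrt 1) ^ 6 = (1 : ℝ) ^ 6 * 1 ^ 3 := by simp

end Summit.QuantumFields.BalabanUV.T4Continuum.NE7b.SupWhitenedVertexMomentLetters

end
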